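import Summits.ABC.IUTFork.Repair.RHHullThresholdExact
import Summits.ABC.IUTFork.Conditional.WRowHexLamSevenTriplesTwentyNine
import Summits.ABC.IUTFork.Conditional.WRowHexLamSevenTwentyNineRefutedCellsA
import HarnessLib

/-!
# R-W WINDOW numerics, HEX family `λ_k = 1/2 + 2/7^k` at `k = 29`: the REFUTED BAND's INTEGER CELLS, second half (part (R-cells); the first member's / lower piece lemmas are in `…RefutedCellsA.lean`, the W-lane shapes in `…RefutedBand.lean`) —
# top-label `HullCell` failures over the sharp class for `(ratPoint λ_29, l)` for EVERY prime `481 ≤ l ≤ 33911153561`, e-robustly and UNIFORMLY in `l`; glue: every prime `11 ≤ l ≤ 33911153561`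

PROOF-ONLY file (D-0012; 0 definitions, 0 `Prop` facts, no instance, no notation) of the abc-iut cell (W6 cone-prover seat
abc-iut-w6-d055, gen 16; row «W:HEX-AXIS-REST-3», `k = 29`, part (R); generator = abc-iut-C-cert-1 g9's gen_ref.py analytic piece plan run from HOME/staging/w6/w6-d055/g16/hexgen/build3.py; byte models C-cert-1's `k = 22 / 24` files p525962 · p526495 / p526937 · p527491, from the `k = 10` template p508090).
TAKES NO SIDE on [IUTchIII] Cor. 3.12 (S. Mochizuki, *Inter-universal Teichmüller theory III*, Cor. 3.12 p. 173–174; Step (xi-f) p. 184) or on any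
author; «refuted as typed» ≠ «refuted in print». BEFORE THIS FILE (BY NAME): at `k = 29` the K-line object FAILS at every prime `11 ≤ l ≤ 479` (abc-iut-W-neg-2's `HexRad.not_pilotKummerCompatHull_lamSeven_rad_eleven`, every `k ≥ 11`); no theorem names a level `l ≥ 481`.
THIS FILE: at the pole `p = 7` of the HEX29 triple `3219905755813179726837611 + 3219905755813179726837603 = 6439811511626359453675214` (`v = v₇(abc) = 29`; prelude `WRowHexLamSevenTriplesTwentyNine`) abc-iut-W-neg-1's SHARP local-type
class (`WRow.localType_class_triple_sharp`, p498814 §1) leaves `A ∈ {15, 30}`; per member and turning-point piece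
(A = 15: a₀ = 4 on 481 ≤ l ≤ 959; A = 15: a₀ = 5 on 961 ≤ l ≤ 6721; A = 15: a₀ = 6 on 6723 ≤ l ≤ 47059; A = 15: a₀ = 7 on 47061 ≤ l ≤ 329417; A = 15: a₀ = 8 on 329419 ≤ l ≤ 2305919; A = 15: a₀ = 9 on 2305921 ≤ l ≤ 16141441; A = 15: a₀ = 10 on 16141443 ≤ l ≤ 112990099; A = 15: a₀ = 11 on 112990101 ≤ l ≤ 790930697; A = 15: a₀ = 12 on 790930699 ≤ l ≤ 5536514879; A = 15: a₀ = 13 on 5536514881 ≤ l ≤ 33911153577; A = 30: a₀ = 5 on 481 ≤ l ≤ 3361; A = 30: a₀ = 6 on 3363 ≤ l ≤ 23529; A = 30: a₀ = 7 on 23531 ≤ l ≤ 164707; A = 30: a₀ = 8 on 164709 ≤ l ≤ 1152959; A = 30: a₀ = 9 on 1152961 ≤ l ≤ 8070721; A = 30: a₀ = 10 on 8070723 ≤ l ≤ 56495049; A = 30: a₀ = 11 on 56495051 ≤ l ≤ 395465347; A = 30: a₀ = 12 on 395465349 ≤ l ≤ 2768257439; A = 30: a₀ = 13 on 2768257441 ≤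 l ≤ 19377802081; A = 30: a₀ = 14 on 19377802083 ≤ l ≤ 33911153577) the top-label cell of R-H row 4's `HullCell` FAILS by a
floor-free downward parabola (`e·⌊X/e⌋ ≥ X − e + 1`, inner radius bounded by `6·r_in ≤ A·l + 6`), with no exact-floor literal level (the floor-free pieces reach the last refuted prime).
W-neg-1's three sockets (`Cor312LicenceTripleHullCellRefuteTameSharp` §2), transported to `ratPoint ((2 : ℚ)⁻¹ + 2/7^k)`, `k = 29`, give the three W-lane shapes
`WRow.not_licence_lamSeven_twentyNine_band` / `WRow.not_exists_qPinned_and_hull_lamSeven_twentyNine_band` / `GenuineK.not_pilotKummerCompatHull_chosen_lamSeven_twentyNine_band`,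
and the GLUE `GenuineK.not_pilotKummerCompatHull_chosen_lamSeven_twentyNine_le` (every prime `11 ≤ l ≤ 33911153561`). DESK (three desks agree: abc-iut-rw-num-lead g5's two-engine census HOME/plan/rescue/R-W/HEX-AXIS-CENSUS.tsv 23abd49ba74dfe76 — engine A (python exact) ≡ engine B (PARI, kit j277535) —
and this seat's generator arithmetic (abc-iut-C-cert-1 g9's analytic piece plan / slot-model check, HOME/staging/w6/w6-d055/g16/hexgen/desk3.py)): the exact top-label cell fails at every prime of the band and first holds at `l = 33911153599`; the
inhabited band from there is part (I) (`WRow.licence_lamSeven_twentyNine_all`), NOT claimed here. These levels are NOT rows of the R-W WINDOW-TABLE.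
HONEST SCOPE: OUR sharp containers and Dupuy–Hilado's typed (Ind1)/(Ind2); the per-label licence is a STRONGER-THAN-PRINT sufficient form of Step (xi-f);
admissibility / Szpiro-badness / (P6) of `(ratPoint λ_29, l)` and NON-EMPTINESS of the datum type are NOT claimed (a «∀ T» statement is vacuous if no datum
exists); nothing about the printed inequality, the number-level `Cor22.Cor312AtDatum` or any author's intended hull; typed ≠ proved; instantiated ≠ endorsed; no abc claim.
[cite: Mochizuki2012, IUTchI Ex. 3.2 (iv) p. 71; IUTchIII Cor. 3.12 Step (xi-d) p. 183, (xi-f) p. 184; IUTchIV Prop. 1.1 p. 9, Prop. 1.2 (i)(ii) p. 10, Thm. 1.10 p. 22, Cor. 2.2 (ii) proof (P5) p. 46]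
[cite: DupuyHilado2025, §3.3, §3.4, §4.9, §4.12] [cite: SilvermanATAEC1994, V.5 Thm. 5.3 and Cor. 5.4] [claim: Mochizuki2012, status: disputed] for every IUT sentence quoted.
-/

noncomputable section

open Set Function NumberField IsDedekindDomain

namespace Summit.ABC.IUTFork.Conditional

open Thm311 Thm311.Real Cor312 Cor312Vol Cor312Prov Literature.IUT.LogThetaLattice Literature.IUT.LogVolume
  Literature.IUT.HodgeTheaters Literature.IUT.LogVolume.ThetaData Literature.IUT.LogVolume.Cor22
open Literature.NumberTheory.NumberFields Literature.NumberTheory.GaloisRepresentations.Ultrametric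
open Literature.NumberTheory.DiophantineGeometry Literature.NumberTheory.DiophantineGeometry.GenEll Summit.ABC.ABC.Theorems
open Summit.ABC.IUTFork.Repair.RH.HullThresholdExact

/-! ## §1. The integer side at `p = 7`, `v = 29`: class `A ∈ {15, 30}`, top label -/

/-- Floor-free failure of the top-label cell, `k = 29`, member `A = 30` (`e = 30l`, `m = 870`), turning point `a₀ = 7` (`r_out = 823543 − 7·30l`),
every `11765 ≤ j ≤ 82353` (`l = 2j + 1`), for ANY inner radius with `6·r_in ≤ 30l + 6` (so for `⌊30l/6⌋ + 1`): `e·⌊X/e⌋ ≥ X − e + 1` and the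
margin is a downward parabola in `j` positive on the range. [folklore] -/
theorem RefBand.not_hullCell_hex29_A30_a7 {j rin : ℤ} (hlo : 11765 ≤ j) (hhi : j ≤ 82353) (hrin : 6 * rin ≤ 30 * (2 * j + 1) + 6) :
    ¬ HullCell (30 * (2 * j + 1)) 870 j rin (823543 - 7 * (30 * (2 * j + 1))) := by
  intro hc
  unfold HullCell at hc
  set e : ℤ := 30 * (2 * j + 1) with he
  have he0 : 0 < e := by rw [he]; omega
  set X : ℤ := j ^ 2 * 870 - j * (e - 1) - (j + 1) * rin with hX
  have hdiv : X - e < e * (X / e) := by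
    have h1 := Int.emod_add_mul_ediv X e
    have h2 := Int.emod_lt_of_pos X he0
    have h3 := Int.emod_nonneg X he0.ne'
    nlinarith [h1, h2, h3]
  have hk1 : 0 ≤ (82353 - j) * (j + 1) := mul_nonneg (by omega) (by omega)
  have hk2 : 0 ≤ (82353 - j) * (j - 11765) := mul_nonneg (by omega) (by omega)
  nlinarith [hdiv, hk1, hk2, hc, hrin, hX]

/-- Floor-free failure of the top-label cell, `k = 29`, member `A = 30` (`e = 30l`, `m = 870`), turning point `a₀ = 8` (`r_out = 5764801 − 8·30l`),
every `82354 ≤ j ≤ 576479` (`l = 2j + 1`), for ANY inner radius with `6·r_in ≤ 30l + 6` (so for `⌊30l/6⌋ + 1`): `e·⌊X/e⌋ ≥ X − e + 1` and the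
margin is a downward parabola in `j` positive on the range. [folklore] -/
theorem RefBand.not_hullCell_hex29_A30_a8 {j rin : ℤ} (hlo : 82354 ≤ j) (hhi : j ≤ 576479) (hrin : 6 * rin ≤ 30 * (2 * j + 1) + 6) :
    ¬ HullCell (30 * (2 * j + 1)) 870 j rin (5764801 - 8 * (30 * (2 * j + 1))) := by
  intro hc
  unfold HullCell at hc
  set e : ℤ := 30 * (2 * j + 1) with he
  have he0 : 0 < e := by rw [he]; omega
  set X : ℤ := j ^ 2 * 870 - j * (e - 1) - (j + 1) * rin with hX
  have hdiv : X - e < e * (X / e) := by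
    have h1 := Int.emod_add_mul_ediv X e
    have h2 := Int.emod_lt_of_pos X he0
    have h3 := Int.emod_nonneg X he0.ne'
    nlinarith [h1, h2, h3]
  have hk1 : 0 ≤ (576479 - j) * (j + 1) := mul_nonneg (by omega) (by omega)
  have hk2 : 0 ≤ (576479 - j) * (j - 82354) := mul_nonneg (by omega) (by omega)
  nlinarith [hdiv, hk1, hk2, hc, hrin, hX]

/-- Floor-free failure of the top-label cell, `k = 29`, member `A = 30` (`e = 30l`, `m = 870`), turning point `a₀ = 9` (`r_out = 40353607 − 9·30l`),
every `576480 ≤ j ≤ 4035360` (`l = 2j + 1`), for ANY inner radius with `6·r_in ≤ 30l + 6` (so for `⌊30l/6⌋ + 1`): `e·⌊X/e⌋ ≥ X − e + 1` and the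
margin is a downward parabola in `j` positive on the range. [folklore] -/
theorem RefBand.not_hullCell_hex29_A30_a9 {j rin : ℤ} (hlo : 576480 ≤ j) (hhi : j ≤ 4035360) (hrin : 6 * rin ≤ 30 * (2 * j + 1) + 6) :
    ¬ HullCell (30 * (2 * j + 1)) 870 j rin (40353607 - 9 * (30 * (2 * j + 1))) := by
  intro hc
  unfold HullCell at hc
  set e : ℤ := 30 * (2 * j + 1) with he
  have he0 : 0 < e := by rw [he]; omega
  set X : ℤ := j ^ 2 * 870 - j * (e - 1) - (j + 1) * rin with hX
  have hdiv : X - e < e * (X / e) := by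
    have h1 := Int.emod_add_mul_ediv X e
    have h2 := Int.emod_lt_of_pos X he0
    have h3 := Int.emod_nonneg X he0.ne'
    nlinarith [h1, h2, h3]
  have hk1 : 0 ≤ (4035360 - j) * (j + 1) := mul_nonneg (by omega) (by omega)
  have hk2 : 0 ≤ (4035360 - j) * (j - 576480) := mul_nonneg (by omega) (by omega)
  nlinarith [hdiv, hk1, hk2, hc, hrin, hX]

/-- Floor-free failure of the top-label cell, `k = 29`, member `A = 30` (`e = 30l`, `m = 870`), turning point `a₀ = 10` (`r_out = 282475249 − 10·30l`),
every `4035361 ≤ j ≤ 28247524` (`l = 2j + 1`), for ANY inner radius with `6·r_in ≤ 30l + 6` (so for `⌊30l/6⌋ + 1`): `e·⌊X/e⌋ ≥ X − e + 1` and the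
margin is a downward parabola in `j` positive on the range. [folklore] -/
theorem RefBand.not_hullCell_hex29_A30_a10 {j rin : ℤ} (hlo : 4035361 ≤ j) (hhi : j ≤ 28247524) (hrin : 6 * rin ≤ 30 * (2 * j + 1) + 6) :
    ¬ HullCell (30 * (2 * j + 1)) 870 j rin (282475249 - 10 * (30 * (2 * j + 1))) := by
  intro hc
  unfold HullCell at hc
  set e : ℤ := 30 * (2 * j + 1) with he
  have he0 : 0 < e := by rw [he]; omega
  set X : ℤ := j ^ 2 * 870 - j * (e - 1) - (j + 1) * rin with hX
  have hdiv : X - e < e * (X / e) := by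
    have h1 := Int.emod_add_mul_ediv X e
    have h2 := Int.emod_lt_of_pos X he0
    have h3 := Int.emod_nonneg X he0.ne'
    nlinarith [h1, h2, h3]
  have hk1 : 0 ≤ (28247524 - j) * (j + 1) := mul_nonneg (by omega) (by omega)
  have hk2 : 0 ≤ (28247524 - j) * (j - 4035361) := mul_nonneg (by omega) (by omega)
  nlinarith [hdiv, hk1, hk2, hc, hrin, hX]

/-- Floor-free failure of the top-label cell, `k = 29`, member `A = 30` (`e = 30l`, `m = 870`), turning point `a₀ = 11` (`r_out = 1977326743 − 11·30l`),
every `28247525 ≤ j ≤ 197732673` (`l = 2j + 1`), for ANY inner radius with `6·r_in ≤ 30l + 6` (so for `⌊30l/6⌋ + 1`): `e·⌊X/e⌋ ≥ X − e + 1` and the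
margin is a downward parabola in `j` positive on the range. [folklore] -/
theorem RefBand.not_hullCell_hex29_A30_a11 {j rin : ℤ} (hlo : 28247525 ≤ j) (hhi : j ≤ 197732673) (hrin : 6 * rin ≤ 30 * (2 * j + 1) + 6) :
    ¬ HullCell (30 * (2 * j + 1)) 870 j rin (1977326743 - 11 * (30 * (2 * j + 1))) := by
  intro hc
  unfold HullCell at hc
  set e : ℤ := 30 * (2 * j + 1) with he
  have he0 : 0 < e := by rw [he]; omega
  set X : ℤ := j ^ 2 * 870 - j * (e - 1) - (j + 1) * rin with hX
  have hdiv : X - e < e * (X / e) := by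
    have h1 := Int.emod_add_mul_ediv X e
    have h2 := Int.emod_lt_of_pos X he0
    have h3 := Int.emod_nonneg X he0.ne'
    nlinarith [h1, h2, h3]
  have hk1 : 0 ≤ (197732673 - j) * (j + 1) := mul_nonneg (by omega) (by omega)
  have hk2 : 0 ≤ (197732673 - j) * (j - 28247525) := mul_nonneg (by omega) (by omega)
  nlinarith [hdiv, hk1, hk2, hc, hrin, hX]

/-- Floor-free failure of the top-label cell, `k = 29`, member `A = 30` (`e = 30l`, `m = 870`), turning point `a₀ = 12` (`r_out = 13841287201 − 12·30l`),
every `197732674 ≤ j ≤ 1384128719` (`l = 2j + 1`), for ANY inner radius with `6·r_in ≤ 30l + 6` (so for `⌊30l/6⌋ + 1`): `e·⌊X/e⌋ ≥ X − e + 1` and the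
margin is a downward parabola in `j` positive on the range. [folklore] -/
theorem RefBand.not_hullCell_hex29_A30_a12 {j rin : ℤ} (hlo : 197732674 ≤ j) (hhi : j ≤ 1384128719) (hrin : 6 * rin ≤ 30 * (2 * j + 1) + 6) :
    ¬ HullCell (30 * (2 * j + 1)) 870 j rin (13841287201 - 12 * (30 * (2 * j + 1))) := by
  intro hc
  unfold HullCell at hc
  set e : ℤ := 30 * (2 * j + 1) with he
  have he0 : 0 < e := by rw [he]; omega
  set X : ℤ := j ^ 2 * 870 - j * (e - 1) - (j + 1) * rin with hX
  have hdiv : X - e < e * (X / e) := by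
    have h1 := Int.emod_add_mul_ediv X e
    have h2 := Int.emod_lt_of_pos X he0
    have h3 := Int.emod_nonneg X he0.ne'
    nlinarith [h1, h2, h3]
  have hk1 : 0 ≤ (1384128719 - j) * (j + 1) := mul_nonneg (by omega) (by omega)
  have hk2 : 0 ≤ (1384128719 - j) * (j - 197732674) := mul_nonneg (by omega) (by omega)
  nlinarith [hdiv, hk1, hk2, hc, hrin, hX]

/-- Floor-free failure of the top-label cell, `k = 29`, member `A = 30` (`e = 30l`, `m = 870`), turning point `a₀ = 13` (`r_out = 96889010407 − 13·30l`),
every `1384128720 ≤ j ≤ 9688901040` (`l = 2j + 1`), for ANY inner radius with `6·r_in ≤ 30l + 6` (so for `⌊30l/6⌋ + 1`): `e·⌊X/e⌋ ≥ X − e + 1` and the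
margin is a downward parabola in `j` positive on the range. [folklore] -/
theorem RefBand.not_hullCell_hex29_A30_a13 {j rin : ℤ} (hlo : 1384128720 ≤ j) (hhi : j ≤ 9688901040) (hrin : 6 * rin ≤ 30 * (2 * j + 1) + 6) :
    ¬ HullCell (30 * (2 * j + 1)) 870 j rin (96889010407 - 13 * (30 * (2 * j + 1))) := by
  intro hc
  unfold HullCell at hc
  set e : ℤ := 30 * (2 * j + 1) with he
  have he0 : 0 < e := by rw [he]; omega
  set X : ℤ := j ^ 2 * 870 - j * (e - 1) - (j + 1) * rin with hX
  have hdiv : X - e < e * (X / e) := by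
    have h1 := Int.emod_add_mul_ediv X e
    have h2 := Int.emod_lt_of_pos X he0
    have h3 := Int.emod_nonneg X he0.ne'
    nlinarith [h1, h2, h3]
  have hk1 : 0 ≤ (9688901040 - j) * (j + 1) := mul_nonneg (by omega) (by omega)
  have hk2 : 0 ≤ (9688901040 - j) * (j - 1384128720) := mul_nonneg (by omega) (by omega)
  nlinarith [hdiv, hk1, hk2, hc, hrin, hX]

/-- Floor-free failure of the top-label cell, `k = 29`, member `A = 30` (`e = 30l`, `m = 870`), turning point `a₀ = 14` (`r_out = 678223072849 − 14·30l`),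
every `9688901041 ≤ j ≤ 16955576788` (`l = 2j + 1`), for ANY inner radius with `6·r_in ≤ 30l + 6` (so for `⌊30l/6⌋ + 1`): `e·⌊X/e⌋ ≥ X − e + 1` and the
margin is a downward parabola in `j` positive on the range. [folklore] -/
theorem RefBand.not_hullCell_hex29_A30_a14 {j rin : ℤ} (hlo : 9688901041 ≤ j) (hhi : j ≤ 16955576788) (hrin : 6 * rin ≤ 30 * (2 * j + 1) + 6) :
    ¬ HullCell (30 * (2 * j + 1)) 870 j rin (678223072849 - 14 * (30 * (2 * j + 1))) := by
  intro hc
  unfold HullCell at hc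
  set e : ℤ := 30 * (2 * j + 1) with he
  have he0 : 0 < e := by rw [he]; omega
  set X : ℤ := j ^ 2 * 870 - j * (e - 1) - (j + 1) * rin with hX
  have hdiv : X - e < e * (X / e) := by
    have h1 := Int.emod_add_mul_ediv X e
    have h2 := Int.emod_lt_of_pos X he0
    have h3 := Int.emod_nonneg X he0.ne'
    nlinarith [h1, h2, h3]
  have hk1 : 0 ≤ (16955576788 - j) * (j + 1) := mul_nonneg (by omega) (by omega)
  have hk2 : 0 ≤ (16955576788 - j) * (j - 9688901041) := mul_nonneg (by omega) (by omega)
  nlinarith [hdiv, hk1, hk2, hc, hrin, hX]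

/-- **The engine's `hcell` for the HEX29 triple at `p = 7` (`v = 29`), odd `481 ≤ l ≤ 33911153577`, top label.** The sharp clauses force
`A ∈ {15, 30}`; per member and turning-point piece the cell fails by the floor-free lemmas above, at the literal levels by the exact floor. [folklore] -/
theorem RefBand.cells_hex29_band {l : ℕ} (hlo : 481 ≤ l) (hhi : l ≤ 33911153577) (hodd : Odd l) {i : ℕ} (hi : i + 1 = (l - 1) / 2)
    (A : ℕ) (hA30 : A ∣ 30) (hA15 : 15 ∣ A * 29) (hAev : Even 29 → A ∣ 15) (hA3 : 3 ∣ 29 → A ∣ 10) (hA5 : 5 ∣ 29 → A ∣ 6) :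
    ∃ a₀ : ℕ, (∀ s : ℕ, s < a₀ → (1 : ℤ) * ((7 : ℕ) : ℤ) ^ s * (((7 : ℕ) : ℤ) - 1) < ((A * l : ℕ) : ℤ)) ∧
      ((A * l : ℕ) : ℤ) ≤ 1 * ((7 : ℕ) : ℤ) ^ a₀ * (((7 : ℕ) : ℤ) - 1) ∧
      ¬ HullCell ((A * l : ℕ) : ℤ) ((A * 29 : ℕ) : ℤ) ((i : ℤ) + 1) (((A * l) / ((7 : ℕ) - 1) + 1 : ℕ) : ℤ)
        (((7 : ℕ) : ℤ) ^ a₀ - (a₀ : ℤ) * ((A * l : ℕ) : ℤ)) := by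
  have hAg : A ∣ 30 := by
    exact hA30
  have hdA : 15 ∣ A := by
    have h' : 15 ∣ A * 29 := Nat.dvd_trans (by norm_num) hA15
    exact (Nat.Coprime.dvd_of_dvd_mul_right (by norm_num : Nat.Coprime 15 29) h')
  have hA : A = 15 ∨ A = 30 := by
    have h1 : A ≤ 30 := Nat.le_of_dvd (by norm_num) hAg
    have h2 : 0 < A := Nat.pos_of_dvd_of_pos hAg (by norm_num)
    interval_cases A <;> omega
  obtain ⟨j, hj⟩ := hodd
  have hij : (i : ℤ) + 1 = (j : ℤ) := by
    have : i + 1 = j := by omega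
    exact_mod_cast this
  rcases hA with rfl | rfl
  · have hrin : (6 : ℤ) * (((((15 * l) / ((7 : ℕ) - 1) + 1 : ℕ) : ℤ))) ≤ 15 * (2 * (j : ℤ) + 1) + 6 := by
      have h0 : ((7 : ℕ) - 1) * ((15 * l) / ((7 : ℕ) - 1)) ≤ 15 * l := Nat.mul_div_le _ _
      have h1 : (6 : ℤ) * ((((15 * l) / ((7 : ℕ) - 1) : ℕ) : ℤ)) ≤ ((15 * l : ℕ) : ℤ) := by exact_mod_cast h0
      push_cast at h1 ⊢; omega
    have he : ((15 * l : ℕ) : ℤ) = 15 * (2 * (j : ℤ) + 1) := by push_cast; omega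
    have hm : ((15 * 29 : ℕ) : ℤ) = 435 := by norm_num
    by_cases hp0 : 481 ≤ l ∧ l ≤ 959
    · refine ⟨4, fun s hs => ?_, ?_, ?_⟩
      · interval_cases s <;> norm_num <;> omega
      · norm_num; omega
      · have hro : (((7 : ℕ) : ℤ) ^ 4 - ((4 : ℕ) : ℤ) * ((15 * l : ℕ) : ℤ)) = 2401 - 4 * (15 * (2 * (j : ℤ) + 1)) := by
          push_cast; omega
        rw [hro, hij, he, hm]
        exact RefBand.not_hullCell_hex29_A15_a4 (by omega) (by omega) hrin
    by_cases hp1 : 961 ≤ l ∧ l ≤ 6721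
    · refine ⟨5, fun s hs => ?_, ?_, ?_⟩
      · interval_cases s <;> norm_num <;> omega
      · norm_num; omega
      · have hro : (((7 : ℕ) : ℤ) ^ 5 - ((5 : ℕ) : ℤ) * ((15 * l : ℕ) : ℤ)) = 16807 - 5 * (15 * (2 * (j : ℤ) + 1)) := by
          push_cast; omega
        rw [hro, hij, he, hm]
        exact RefBand.not_hullCell_hex29_A15_a5 (by omega) (by omega) hrin
    by_cases hp2 : 6723 ≤ l ∧ l ≤ 47059
    · refine ⟨6, fun s hs => ?_, ?_, ?_⟩
      · interval_cases s <;> norm_num <;> omega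
      · norm_num; omega
      · have hro : (((7 : ℕ) : ℤ) ^ 6 - ((6 : ℕ) : ℤ) * ((15 * l : ℕ) : ℤ)) = 117649 - 6 * (15 * (2 * (j : ℤ) + 1)) := by
          push_cast; omega
        rw [hro, hij, he, hm]
        exact RefBand.not_hullCell_hex29_A15_a6 (by omega) (by omega) hrin
    by_cases hp3 : 47061 ≤ l ∧ l ≤ 329417
    · refine ⟨7, fun s hs => ?_, ?_, ?_⟩
      · interval_cases s <;> norm_num <;> omega
      · norm_num; omega
      · have hro : (((7 : ℕ) : ℤ) ^ 7 - ((7 : ℕ) : ℤ) * ((15 * l : ℕ) : ℤ)) = 823543 - 7 * (15 * (2 * (j : ℤ) + 1)) := by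
          push_cast; omega
        rw [hro, hij, he, hm]
        exact RefBand.not_hullCell_hex29_A15_a7 (by omega) (by omega) hrin
    by_cases hp4 : 329419 ≤ l ∧ l ≤ 2305919
    · refine ⟨8, fun s hs => ?_, ?_, ?_⟩
      · interval_cases s <;> norm_num <;> omega
      · norm_num; omega
      · have hro : (((7 : ℕ) : ℤ) ^ 8 - ((8 : ℕ) : ℤ) * ((15 * l : ℕ) : ℤ)) = 5764801 - 8 * (15 * (2 * (j : ℤ) + 1)) := by
          push_cast; omega
        rw [hro, hij, he, hm]
        exact RefBand.not_hullCell_hex29_A15_a8 (by omega) (by omega) hrin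
    by_cases hp5 : 2305921 ≤ l ∧ l ≤ 16141441
    · refine ⟨9, fun s hs => ?_, ?_, ?_⟩
      · interval_cases s <;> norm_num <;> omega
      · norm_num; omega
      · have hro : (((7 : ℕ) : ℤ) ^ 9 - ((9 : ℕ) : ℤ) * ((15 * l : ℕ) : ℤ)) = 40353607 - 9 * (15 * (2 * (j : ℤ) + 1)) := by
          push_cast; omega
        rw [hro, hij, he, hm]
        exact RefBand.not_hullCell_hex29_A15_a9 (by omega) (by omega) hrin
    by_cases hp6 : 16141443 ≤ l ∧ l ≤ 112990099
    · refine ⟨10, fun s hs => ?_, ?_, ?_⟩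
      · interval_cases s <;> norm_num <;> omega
      · norm_num; omega
      · have hro : (((7 : ℕ) : ℤ) ^ 10 - ((10 : ℕ) : ℤ) * ((15 * l : ℕ) : ℤ)) = 282475249 - 10 * (15 * (2 * (j : ℤ) + 1)) := by
          push_cast; omega
        rw [hro, hij, he, hm]
        exact RefBand.not_hullCell_hex29_A15_a10 (by omega) (by omega) hrin
    by_cases hp7 : 112990101 ≤ l ∧ l ≤ 790930697
    · refine ⟨11, fun s hs => ?_, ?_, ?_⟩
      · interval_cases s <;> norm_num <;> omega
      · norm_num; omega
      · have hro : (((7 : ℕ) : ℤ) ^ 11 - ((11 : ℕ) : ℤ) * ((15 * l : ℕ) : ℤ)) = 1977326743 - 11 * (15 * (2 * (j : ℤ) + 1)) := by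
          push_cast; omega
        rw [hro, hij, he, hm]
        exact RefBand.not_hullCell_hex29_A15_a11 (by omega) (by omega) hrin
    by_cases hp8 : 790930699 ≤ l ∧ l ≤ 5536514879
    · refine ⟨12, fun s hs => ?_, ?_, ?_⟩
      · interval_cases s <;> norm_num <;> omega
      · norm_num; omega
      · have hro : (((7 : ℕ) : ℤ) ^ 12 - ((12 : ℕ) : ℤ) * ((15 * l : ℕ) : ℤ)) = 13841287201 - 12 * (15 * (2 * (j : ℤ) + 1)) := by
          push_cast; omega
        rw [hro, hij, he, hm]
        exact RefBand.not_hullCell_hex29_A15_a12 (by omega) (by omega) hrin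
    by_cases hp9 : 5536514881 ≤ l ∧ l ≤ 33911153577
    · refine ⟨13, fun s hs => ?_, ?_, ?_⟩
      · interval_cases s <;> norm_num <;> omega
      · norm_num; omega
      · have hro : (((7 : ℕ) : ℤ) ^ 13 - ((13 : ℕ) : ℤ) * ((15 * l : ℕ) : ℤ)) = 96889010407 - 13 * (15 * (2 * (j : ℤ) + 1)) := by
          push_cast; omega
        rw [hro, hij, he, hm]
        exact RefBand.not_hullCell_hex29_A15_a13 (by omega) (by omega) hrin
    -- no level is left: the pieces cover the whole band
    exfalso; omega
  · have hrin : (6 : ℤ) * (((((30 * l) / ((7 : ℕ) - 1) + 1 : ℕ) : ℤ))) ≤ 30 * (2 * (j : ℤ) + 1) + 6 := by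
      have h0 : ((7 : ℕ) - 1) * ((30 * l) / ((7 : ℕ) - 1)) ≤ 30 * l := Nat.mul_div_le _ _
      have h1 : (6 : ℤ) * ((((30 * l) / ((7 : ℕ) - 1) : ℕ) : ℤ)) ≤ ((30 * l : ℕ) : ℤ) := by exact_mod_cast h0
      push_cast at h1 ⊢; omega
    have he : ((30 * l : ℕ) : ℤ) = 30 * (2 * (j : ℤ) + 1) := by push_cast; omega
    have hm : ((30 * 29 : ℕ) : ℤ) = 870 := by norm_num
    by_cases hp0 : 481 ≤ l ∧ l ≤ 3361
    · refine ⟨5, fun s hs => ?_, ?_, ?_⟩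
      · interval_cases s <;> norm_num <;> omega
      · norm_num; omega
      · have hro : (((7 : ℕ) : ℤ) ^ 5 - ((5 : ℕ) : ℤ) * ((30 * l : ℕ) : ℤ)) = 16807 - 5 * (30 * (2 * (j : ℤ) + 1)) := by
          push_cast; omega
        rw [hro, hij, he, hm]
        exact RefBand.not_hullCell_hex29_A30_a5 (by omega) (by omega) hrin
    by_cases hp1 : 3363 ≤ l ∧ l ≤ 23529
    · refine ⟨6, fun s hs => ?_, ?_, ?_⟩
      · interval_cases s <;> norm_num <;> omega
      · norm_num; omega
      · have hro : (((7 : ℕ) : ℤ) ^ 6 - ((6 : ℕ) : ℤ) * ((30 * l : ℕ) : ℤ)) = 117649 - 6 * (30 * (2 * (j : ℤ) + 1)) := by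
          push_cast; omega
        rw [hro, hij, he, hm]
        exact RefBand.not_hullCell_hex29_A30_a6 (by omega) (by omega) hrin
    by_cases hp2 : 23531 ≤ l ∧ l ≤ 164707
    · refine ⟨7, fun s hs => ?_, ?_, ?_⟩
      · interval_cases s <;> norm_num <;> omega
      · norm_num; omega
      · have hro : (((7 : ℕ) : ℤ) ^ 7 - ((7 : ℕ) : ℤ) * ((30 * l : ℕ) : ℤ)) = 823543 - 7 * (30 * (2 * (j : ℤ) + 1)) := by
          push_cast; omega
        rw [hro, hij, he, hm]
        exact RefBand.not_hullCell_hex29_A30_a7 (by omega) (by omega) hrin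
    by_cases hp3 : 164709 ≤ l ∧ l ≤ 1152959
    · refine ⟨8, fun s hs => ?_, ?_, ?_⟩
      · interval_cases s <;> norm_num <;> omega
      · norm_num; omega
      · have hro : (((7 : ℕ) : ℤ) ^ 8 - ((8 : ℕ) : ℤ) * ((30 * l : ℕ) : ℤ)) = 5764801 - 8 * (30 * (2 * (j : ℤ) + 1)) := by
          push_cast; omega
        rw [hro, hij, he, hm]
        exact RefBand.not_hullCell_hex29_A30_a8 (by omega) (by omega) hrin
    by_cases hp4 : 1152961 ≤ l ∧ l ≤ 8070721
    · refine ⟨9, fun s hs => ?_, ?_, ?_⟩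
      · interval_cases s <;> norm_num <;> omega
      · norm_num; omega
      · have hro : (((7 : ℕ) : ℤ) ^ 9 - ((9 : ℕ) : ℤ) * ((30 * l : ℕ) : ℤ)) = 40353607 - 9 * (30 * (2 * (j : ℤ) + 1)) := by
          push_cast; omega
        rw [hro, hij, he, hm]
        exact RefBand.not_hullCell_hex29_A30_a9 (by omega) (by omega) hrin
    by_cases hp5 : 8070723 ≤ l ∧ l ≤ 56495049
    · refine ⟨10, fun s hs => ?_, ?_, ?_⟩
      · interval_cases s <;> norm_num <;> omega
      · norm_num; omega
      · have hro : (((7 : ℕ) : ℤ) ^ 10 - ((10 : ℕ) : ℤ) * ((30 * l : ℕ) : ℤ)) = 282475249 - 10 * (30 * (2 * (j : ℤ) + 1)) := by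
          push_cast; omega
        rw [hro, hij, he, hm]
        exact RefBand.not_hullCell_hex29_A30_a10 (by omega) (by omega) hrin
    by_cases hp6 : 56495051 ≤ l ∧ l ≤ 395465347
    · refine ⟨11, fun s hs => ?_, ?_, ?_⟩
      · interval_cases s <;> norm_num <;> omega
      · norm_num; omega
      · have hro : (((7 : ℕ) : ℤ) ^ 11 - ((11 : ℕ) : ℤ) * ((30 * l : ℕ) : ℤ)) = 1977326743 - 11 * (30 * (2 * (j : ℤ) + 1)) := by
          push_cast; omega
        rw [hro, hij, he, hm]
        exact RefBand.not_hullCell_hex29_A30_a11 (by omega) (by omega) hrin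
    by_cases hp7 : 395465349 ≤ l ∧ l ≤ 2768257439
    · refine ⟨12, fun s hs => ?_, ?_, ?_⟩
      · interval_cases s <;> norm_num <;> omega
      · norm_num; omega
      · have hro : (((7 : ℕ) : ℤ) ^ 12 - ((12 : ℕ) : ℤ) * ((30 * l : ℕ) : ℤ)) = 13841287201 - 12 * (30 * (2 * (j : ℤ) + 1)) := by
          push_cast; omega
        rw [hro, hij, he, hm]
        exact RefBand.not_hullCell_hex29_A30_a12 (by omega) (by omega) hrin
    by_cases hp8 : 2768257441 ≤ l ∧ l ≤ 19377802081
    · refine ⟨13, fun s hs => ?_, ?_, ?_⟩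
      · interval_cases s <;> norm_num <;> omega
      · norm_num; omega
      · have hro : (((7 : ℕ) : ℤ) ^ 13 - ((13 : ℕ) : ℤ) * ((30 * l : ℕ) : ℤ)) = 96889010407 - 13 * (30 * (2 * (j : ℤ) + 1)) := by
          push_cast; omega
        rw [hro, hij, he, hm]
        exact RefBand.not_hullCell_hex29_A30_a13 (by omega) (by omega) hrin
    by_cases hp9 : 19377802083 ≤ l ∧ l ≤ 33911153577
    · refine ⟨14, fun s hs => ?_, ?_, ?_⟩
      · interval_cases s <;> norm_num <;> omega
      · norm_num; omega
      · have hro : (((7 : ℕ) : ℤ) ^ 14 - ((14 : ℕ) : ℤ) * ((30 * l : ℕ) : ℤ)) = 678223072849 - 14 * (30 * (2 * (j : ℤ) + 1)) := by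
          push_cast; omega
        rw [hro, hij, he, hm]
        exact RefBand.not_hullCell_hex29_A30_a14 (by omega) (by omega) hrin
    -- no level is left: the pieces cover the whole band
    exfalso; omega

end Summit.ABC.IUTFork.Conditional

end
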